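import Literature.Computability.QuantumComplexity.GuardedOpsLocal
import HarnessLib

/-!
# The compiled circuit of a classical program, and of a flag-guarded program

Topic `Literature/Computability/QuantumComplexity`; sequel of `RevGadgets.lean` (`toRevList`, `revEval_toRevList`),
`ReversibleCliffordT.lean` (`revCompile`, `revCompile_mulVec_basisState`), `SandwichCircuit.lean`
(`exists_mem_wiresOf_of_mem_revCompile_toRevList`) and `GuardedOpsLocal.lean`. The tree compiles classical
straight-line programs (`ClOp` lists) to Clifford+`T` circuits always by the same idiom `⟨revCompile (toRevList ops h)⟩`
(`CleanPlaced.circuit`, `CleanXor.circuit`, `PairedCleanXor.circuit`, …); this file names the idiom once and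
collects its four invariants, then specialises them to flag-guarded programs (the routing / copy stages of a
universal machine with slots; Regev, J. ACM 56 (2009), Lemma 3.14):

* `progCircuit ops h` — the compiled circuit; `isOracleFree_progCircuit`, **`isBasisMap_progCircuit`** (its matrix is
  the basis map of `clEval ops`), `exists_mem_wiresOf_of_mem_progCircuit` / `wires_progCircuit_subset` (its gates
  touch only the program's wires), `progCircuit_mem_unitaryGroup`;
* `guardedCircuit flag s ops` — the compiled guarded program; `isBasisMap_guardedCircuit`,
  `wires_guardedCircuit_subset`, and **`localOn_guardedCircuit_of_flag_off` / `localOn_guardedCircuit_of_wires_off`**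
  (the `LocalOn` hypotheses of `IsBasisMap.mulVec_toMatrix_comm_of_localOn` for an inactive, resp. the active, slot).

## References

* M. A. Nielsen, I. L. Chuang, *Quantum Computation and Quantum Information*, CUP 2010, §3.2.5 (reversible
  simulation of classical programs), §4.3 (controlled operations) [NielsenChuang2010].
* O. Regev, *On lattices, learning with errors, random linear codes, and cryptography*, J. ACM 56 (2009), art. 34,
  Lemma 3.14 (proof) [Regev2009].
-/

noncomputable section

namespace Literature.Computability.QuantumComplexity

open Cryptography RevSim RevClean

variable {N : ℕ}

/-- **The compiled circuit of a well-formed classical program.** [cite: NielsenChuang2010, §3.2.5] -/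
def progCircuit (ops : List (ClOp (Fin N))) (h : ∀ op ∈ ops, op.WF) : QCircuit cliffordT N :=
  ⟨revCompile (toRevList ops h)⟩

/-- It is oracle-free. [cite: NielsenChuang2010, §3.2.5] -/
theorem isOracleFree_progCircuit (ops : List (ClOp (Fin N))) (h : ∀ op ∈ ops, op.WF) :
    (progCircuit ops h).IsOracleFree := fun g hg => revCompile_isOracleFree _ g hg

/-- **Its matrix is the basis map of the program's semantics** (for every oracle language, which it ignores).
[cite: NielsenChuang2010, §3.2.5] -/
theorem isBasisMap_progCircuit (A : Language Bool) (ops : List (ClOp (Fin N))) (h : ∀ op ∈ ops, op.WF) :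
    IsBasisMap ((progCircuit ops h).toMatrix A) (clEval ops) := fun z => by
  rw [progCircuit, revCompile_mulVec_basisState, revEval_toRevList]

/-- Its matrix is unitary. [cite: NielsenChuang2010, §3.2.5] -/
theorem progCircuit_mem_unitaryGroup (A : Language Bool) (ops : List (ClOp (Fin N))) (h : ∀ op ∈ ops, op.WF) :
    (progCircuit ops h).toMatrix A ∈ Matrix.unitaryGroup (QReg N) ℂ :=
  QCircuit.toMatrix_mem_unitaryGroup_holds cliffordT_isUnitary_holds A _

/-- **Its gates touch only the program's wires.** [cite: NielsenChuang2010, §3.2.5] -/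
theorem exists_mem_wiresOf_of_mem_progCircuit (ops : List (ClOp (Fin N))) (h : ∀ op ∈ ops, op.WF)
    {g : QGate cliffordT N} (hg : g ∈ (progCircuit ops h).gates) {x : Fin N} (hx : x ∈ g.wires) :
    ∃ op ∈ ops, x ∈ wiresOf op :=
  exists_mem_wiresOf_of_mem_revCompile_toRevList ops h hg hx

/-- Hence its gates lie inside any wire set containing the program's wires. [cite: NielsenChuang2010, §3.2.5] -/
theorem wires_progCircuit_subset (ops : List (ClOp (Fin N))) (h : ∀ op ∈ ops, op.WF) {S : Finset (Fin N)}
    (hS : ∀ op ∈ ops, ∀ x ∈ wiresOf op, x ∈ S) : ∀ g ∈ (progCircuit ops h).gates, g.wires ⊆ S :=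
  fun _ hg x hx => by
    obtain ⟨op, hop, hx'⟩ := exists_mem_wiresOf_of_mem_progCircuit ops h hg hx
    exact hS op hop x hx'

/-! ### Flag-guarded programs -/

/-- **The compiled circuit of the flag-guarded program** `guardOps flag s ops`. [cite: NielsenChuang2010, §4.3] -/
def guardedCircuit (flag s : Fin N) (ops : List (ClOp (Fin N))) (h : ∀ op ∈ ops, op.WF)
    (hfr : ∀ op ∈ ops, ClOp.Fresh flag s op) : QCircuit cliffordT N :=
  progCircuit (guardOps flag s ops) (guardOps_wf flag s ops h hfr)

variable {flag s : Fin N} {ops : List (ClOp (Fin N))} {h : ∀ op ∈ ops, op.WF} {hfr : ∀ op ∈ ops, ClOp.Fresh flag s op}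

/-- It is oracle-free. [cite: NielsenChuang2010, §4.3] -/
theorem isOracleFree_guardedCircuit : (guardedCircuit flag s ops h hfr).IsOracleFree := isOracleFree_progCircuit _ _

/-- Its matrix is the basis map of the guarded semantics. [cite: NielsenChuang2010, §4.3] -/
theorem isBasisMap_guardedCircuit (A : Language Bool) :
    IsBasisMap ((guardedCircuit flag s ops h hfr).toMatrix A) (clEval (guardOps flag s ops)) :=
  isBasisMap_progCircuit A _ _

/-- **Its gates touch only the program's wires, the flag and the scratch wire.** [cite: NielsenChuang2010, §4.3] -/
theorem wires_guardedCircuit_subset {S : Finset (Fin N)} (hfl : flag ∈ S) (hs : s ∈ S)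
    (hS : ∀ op ∈ ops, ∀ x ∈ wiresOf op, x ∈ S) : ∀ g ∈ (guardedCircuit flag s ops h hfr).gates, g.wires ⊆ S :=
  wires_progCircuit_subset _ _ fun op' hop' x hx => by
    rcases mem_wiresOf_guardOps hop' hx with rfl | rfl | ⟨op, hop, hx'⟩
    · exact hfl
    · exact hs
    · exact hS op hop x hx'

variable {T : Finset (Fin N)} {G : Set (QReg N)}

/-- **An inactive slot's guarded circuit is local off the idle set**: on labels whose flag is off it is the identity.
[cite: NielsenChuang2010, §4.3] [cite: Regev2009, Lemma 3.14 (proof)] -/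
theorem localOn_guardedCircuit_of_flag_off (h : ∀ op ∈ ops, op.WF) (hfr : ∀ op ∈ ops, ClOp.Fresh flag s op)
    (hG : ∀ z z' : QReg N, (∀ w, w ∉ T → z w = z' w) → z ∈ G → z' ∈ G)
    (hoff : ∀ z ∈ G, z flag = false) (hs0 : ∀ z ∈ G, z s = false) :
    LocalOn (clEval (guardOps flag s ops)) T G :=
  localOn_clEval_guardOps_of_flags_off flag s ops h hfr hG hs0 hoff

/-- **The active slot's guarded circuit is local off the idle set**: all its wires avoid `T`.
[cite: NielsenChuang2010, §4.3] [cite: Regev2009, Lemma 3.14 (proof)] -/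
theorem localOn_guardedCircuit_of_wires_off (hfl : flag ∉ T) (hs : s ∉ T) (hops : ∀ op ∈ ops, ∀ x ∈ wiresOf op, x ∉ T)
    (hG : ∀ z z' : QReg N, (∀ w, w ∉ T → z w = z' w) → z ∈ G → z' ∈ G) :
    LocalOn (clEval (guardOps flag s ops)) T G :=
  localOn_clEval_guardOps_of_wires_off flag s ops hfl hs hops hG

end Literature.Computability.QuantumComplexity

end
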